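import Summits.QuantumAdvantage.QuantumAdvantage.Theorems.CubicForrelationNearExactIsExactTwelveTypeO512At931

/-!
# Crux `CubicForrelation.NearExactIsExact` (stmt-QuantumAdvantage-14043) — n = 12, type O ABOVE `930/1024`: the 9-flat base set `512` is dead on
  the whole open window `(930/1024, 932/1024)`, not only at `931/1024`

Certificate seat `b2b-cforr-cert` (gen 19).  HONEST FRAMING: kernel-checked lemmas (standard axioms) for the type-O branch of the windows below
`932/1024` at `n = 12`; NO new value of `θ₁₂` by itself (the level-`≥ 6` × level-`≥ 6` pairs remain).  NOT summit progress.

* `to19_typeO_E512_gt930_boundary`: type O, `#E = 512`, `Φ > 930/1024` ⇒ `Φ = 931/1024` exactly, with exactly one wild point of height `±8`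
  (excess budget `< 3840`: the levels of `to15_typeO_E_ge_768` still collapse, a wild point costs `3712` or `≥ 3968`); combined with
  `to19_typeO_E512_ge931_false` the 9-flat pattern is dead for every `Φ > 930/1024` (`to19_typeO_E512_gt930_false`).
(The base set `960` above `930/1024` is killed in `…TwelveTypeO960Above930.lean`; with `…TwelveTypeO931Shape` — `#E ∈ {512, 960}` above
`930/1024` — there is NO type-O side above `930/1024`.)

References: Kasami–Tokura (1970); MacWilliams–Sloane (1977) Ch. 14–15; O'Donnell (2014) §1.4.  Axioms: the standard three.
-/

set_option linter.dupNamespace false -- D-0017: single-problem summit ⇒ `QuantumAdvantage.QuantumAdvantage` by design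

noncomputable section

namespace Summit.QuantumAdvantage.QuantumAdvantage.Theorems.CubicForrelation.NearExactIsExact

open Finset
open Literature.Computability.QuantumComplexity
open Literature.Computability.QuantumComplexity.BuzetChailloux (bxor zeroVec bxor_bxor_cancel_left bxor_zeroVec zeroVec_bxor bxor_comm
  bxor_self twist_zeroVec_right twist_bxor_right signOf_sq sum_twist_left)
open Literature.Computability.QuantumComplexity.DerivativeWalsh (W sum_W_sq)
open Literature.Computability.QuantumComplexity.Simon (twist_eq_one_or)
open Summit.QuantumAdvantage.QuantumAdvantage.Theorems.NearExactIsExact.Negative (TypeOTwelve.no_caseA TypeOTwelve.cube_sum_dvd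
  TypeOTwelve.typeO_of_exists_odd)
open Summit.QuantumAdvantage.QuantumAdvantage.Theorems.SignedCubicForrelationNotPrBPP (knf_isDegLeFun_ip)

/-! ### The 9-flat base pattern above `930/1024` -/

/-- **Type O, `#E = 512`, `Φ > 930/1024` on 12 bits: `Φ = 931/1024` exactly and there is exactly one wild point, of height `±8`.**  (The
boundary analysis of `to19_typeO_E512_boundary` with the excess budget `< 3840` instead of `≤ 3712`: the levels still collapse, a wild point costs
`3712`, `3968` or more, two cost too much, so the excess is exactly `3712`.)  Finite-slice statement; NOT summit progress. [this work] -/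
theorem to19_typeO_E512_gt930_boundary (f g : (Fin (6 + 6) → Bool) → Bool) (hf : IsDegLeFun 3 f) (hg : IsDegLeFun 3 g)
    (u : (Fin (6 + 6) → Bool) → ℤ) (hu : ∀ x, W (fun y => signOf (g y)) x = (2 : ℝ) ^ 4 * (u x : ℝ))
    (hodd : ∃ x, Odd (u x)) (hE512 : #(univ.filter fun x : Fin (6 + 6) → Bool => (Odd (u x / 2) ↔ Odd (u x / 2 / 2))) = 512)
    (hΦ : (930 / 1024 : ℝ) < forrelation f g) :
    forrelation f g = 931 / 1024 ∧ ∃ x₀ : Fin (6 + 6) → Bool,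
      (∀ x, x ≠ x₀ → u x - 4 * sZ (f x) =
        sZ (decide (Odd (u x / 2))) * (1 - 4 * (if (Odd (u x / 2) ↔ Odd (u x / 2 / 2)) then 1 else 0))) ∧
      (u x₀ - 4 * sZ (f x₀) = sZ (decide (Odd (u x₀ / 2))) * (1 - 4 * (if (Odd (u x₀ / 2) ↔ Odd (u x₀ / 2 / 2)) then 1 else 0)) + 64 ∨
        u x₀ - 4 * sZ (f x₀) = sZ (decide (Odd (u x₀ / 2))) * (1 - 4 * (if (Odd (u x₀ / 2) ↔ Odd (u x₀ / 2 / 2)) then 1 else 0)) - 64) := by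
  classical
  have hΦle : forrelation f g ≤ 59 / 64 := to12_typeO_le f g hf hg u hu hodd
  have hall : ∀ x, Odd (u x) := TypeOTwelve.typeO_of_exists_odd g u hg hu hodd
  have hu' : ∀ x, W (fun y => signOf (g y)) x = (2 : ℝ) ^ (2 * 2) * (u x : ℝ) := fun x => (hu x).trans (by norm_num)
  have hd1 : IsDegLeFun 1 (fun x => decide (Odd (u x / 2))) := z2_digitOne 2 g u hg hu' hall
  have hd2 : IsDegLeFun 3 (fun x => decide (Odd (u x / 2 / 2))) := z2_digitTwo 2 g u hg hu' hall
  set E := univ.filter (fun x : Fin (6 + 6) → Bool => (Odd (u x / 2) ↔ Odd (u x / 2 / 2))) with hEdef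
  have hmemE : ∀ x, x ∈ E ↔ (Odd (u x / 2) ↔ Odd (u x / 2 / 2)) := fun x => by simp [hEdef]
  have hdegE : IsDegLeFun (2 + 1) (fun x => (decide (Odd (u x / 2)) ^^ decide (Odd (u x / 2 / 2))) ^^ true) :=
    tb_isDegLeFun_xor_const (bb_isDegLeFun_bxor (hd1.mono (by norm_num)) hd2) true
  have hsetE : (univ.filter fun x : Fin (6 + 6) → Bool =>
      ((decide (Odd (u x / 2)) ^^ decide (Odd (u x / 2 / 2))) ^^ true) = true) = E := by
    rw [hEdef]
    apply filter_congr
    intro x _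
    by_cases h1 : Odd (u x / 2) <;> by_cases h2 : Odd (u x / 2 / 2) <;> simp [h1, h2]
  have hsumE : (∑ x, (if (Odd (u x / 2) ↔ Odd (u x / 2 / 2)) then 1 else 0 : ℤ)) = #E := by rw [sum_boole]
  -- budget `Σ τ² = 2¹⁷(1 − Φ) < 12032`
  have hbud := tw12_budget f g u hu
  have hT : (∑ x, (u x - 4 * sZ (f x)) ^ 2 : ℤ) ≤ 12031 := by
    have h' : ((∑ x, (u x - 4 * sZ (f x)) ^ 2 : ℤ) : ℝ) < 12032 := by rw [hbud]; linarith
    have h'' : (∑ x, (u x - 4 * sZ (f x)) ^ 2 : ℤ) < 12032 := by exact_mod_cast h'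
    omega
  -- base pattern `τ₀` and wild function `v`: `τ = τ₀ + 8v`
  choose v hv using fun x => to12_pt_mod8 (u x) (sZ (f x)) (hall x) (tp_sZ_cases (f x))
  set τ₀ : (Fin (6 + 6) → Bool) → ℤ := fun x =>
    sZ (decide (Odd (u x / 2))) * (1 - 4 * (if (Odd (u x / 2) ↔ Odd (u x / 2 / 2)) then 1 else 0)) with hτ₀def
  have hvx : ∀ x, u x - 4 * sZ (f x) = τ₀ x + 8 * v x := fun x => hv x
  have hτ₀val : ∀ x, τ₀ x = 1 ∨ τ₀ x = -1 ∨ τ₀ x = 3 ∨ τ₀ x = -3 := by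
    intro x
    simp only [τ₀]
    rcases tp_sZ_cases (decide (Odd (u x / 2))) with h | h <;> rw [h] <;> split_ifs <;> norm_num
  have hτ₀sq : ∀ x, τ₀ x ^ 2 = 1 + 8 * (if (Odd (u x / 2) ↔ Odd (u x / 2 / 2)) then 1 else 0 : ℤ) := by
    intro x
    simp only [τ₀]
    rcases tp_sZ_cases (decide (Odd (u x / 2))) with h | h <;> rw [h] <;> split_ifs <;> norm_num
  have hsumτ₀ : ∑ x, τ₀ x ^ 2 = 4096 + 8 * #E := by
    rw [sum_congr rfl fun x _ => hτ₀sq x, sum_add_distrib, ← mul_sum, hsumE, sum_const, card_univ, Fintype.card_fun,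
      Fintype.card_bool, Fintype.card_fin]
    norm_num
  -- excess decomposition `Σ τ² = Σ τ₀² + Σ X`, `X ≥ 0`
  set X : (Fin (6 + 6) → Bool) → ℤ := fun x => (τ₀ x + 8 * v x) ^ 2 - τ₀ x ^ 2 with hXdef
  have hXnn : ∀ x, 0 ≤ X x := fun x => to12_excess_nonneg _ _ (hτ₀val x)
  have hTdec : (∑ x, (u x - 4 * sZ (f x)) ^ 2 : ℤ) = ∑ x, τ₀ x ^ 2 + ∑ x, X x := by
    rw [← sum_add_distrib]
    exact sum_congr rfl fun x _ => by rw [hvx x]; simp only [X]; ring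
  have hTX : (∑ x, (u x - 4 * sZ (f x)) ^ 2 : ℤ) = 8192 + ∑ x, X x := by rw [hTdec, hsumτ₀, hE512]; norm_num
  have hXsum : ∑ x, X x ≤ 3839 := by linarith
  -- `E` is a 9-flat
  have hmwE := mw_flat_of_minweight 2 _ hdegE (by rw [hsetE, hE512]; norm_num)
  rw [hsetE] at hmwE
  obtain ⟨h0E, haddE, hcardVE, hcosetE⟩ := hmwE
  set VE := univ.filter (fun a : Fin (6 + 6) → Bool => ∀ x,
    ((decide (Odd (u (bxor x a) / 2)) ^^ decide (Odd (u (bxor x a) / 2 / 2))) ^^ true) =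
      ((decide (Odd (u x / 2)) ^^ decide (Odd (u x / 2 / 2))) ^^ true)) with hVE
  rw [hE512] at hcardVE
  have hEpos : 0 < #E := by rw [hE512]; norm_num
  obtain ⟨xE, hxE⟩ : E.Nonempty := card_pos.1 hEpos
  have hSE : E = VE.image (bxor xE) := hcosetE xE (by
    have h := (hmemE xE).1 hxE
    by_cases h1 : Odd (u xE / 2)
    · have h2 : Odd (u xE / 2 / 2) := h.1 h1
      simp [h1, h2]
    · have h2 : ¬ Odd (u xE / 2 / 2) := fun h' => h1 (h.2 h')
      simp [h1, h2])
  -- the wild identity in coset form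
  have hv' : ∀ x, u x - 4 * sZ (f x) =
      sZ (decide (Odd (u x / 2))) * (1 - 4 * (if x ∈ VE.image (bxor xE) then 1 else 0)) + 8 * v x := by
    intro x
    rw [← hSE, hvx x]
    simp only [τ₀]
    by_cases hx : (Odd (u x / 2) ↔ Odd (u x / 2 / 2))
    · rw [if_pos hx, if_pos ((hmemE x).2 hx)]
    · rw [if_neg hx, if_neg (fun h' => hx ((hmemE x).1 h'))]
  have hcc := fun I => to12_cube_congr f g hf hg u hu hd1 VE xE h0E haddE hcardVE v hv' I
  -- excess of a set of wild points
  have hXset : ∀ (S : Finset (Fin (6 + 6) → Bool)) (c : ℤ), 1 ≤ c → (∀ x ∈ S, c ≤ v x ∨ v x ≤ -c) →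
      16 * c * (4 * c - 3) * #S ≤ ∑ x, X x := by
    intro S c hc hS
    calc 16 * c * (4 * c - 3) * #S = ∑ x ∈ S, 16 * c * (4 * c - 3) := by rw [sum_const, nsmul_eq_mul, mul_comm]
      _ ≤ ∑ x ∈ S, X x := sum_le_sum fun x hx => to12_excess _ _ c (hτ₀val x) hc (hS x hx)
      _ ≤ ∑ x, X x := sum_le_sum_of_subset_of_nonneg (subset_univ _) fun x _ _ => hXnn x
  -- LEVEL 1: `v` is even
  have hv2 : ∀ x, Even (v x) := by
    rcases to12_level v 4 (fun I hI => (hcc I).1 (by omega)) with h | h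
    · exact h
    · exfalso
      have hcnt : (256 : ℤ) ≤ #(univ.filter fun x => Odd (v x)) := by norm_num at h; exact_mod_cast (by omega)
      have hge := hXset (univ.filter fun x => Odd (v x)) 1 le_rfl (fun x hx => by
        obtain ⟨k, hk⟩ := (mem_filter.1 hx).2; omega)
      linarith
  choose v₁ hv₁ using hv2
  have hvv₁ : ∀ x, v x = 2 * v₁ x := fun x => by rw [two_mul]; exact hv₁ x
  -- LEVEL 2: `v/2` is even
  have hv4 : ∀ x, Even (v₁ x) := by
    rcases to12_level v₁ 6 (fun I hI => by
      have h4 := (hcc I).2.1 (by omega)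
      rw [sum_congr rfl (fun x _ => hvv₁ x), ← mul_sum] at h4
      omega) with h | h
    · exact h
    · exfalso
      have hcnt : (64 : ℤ) ≤ #(univ.filter fun x => Odd (v₁ x)) := by norm_num at h; exact_mod_cast (by omega)
      have hge := hXset (univ.filter fun x => Odd (v₁ x)) 2 (by norm_num) (fun x hx => by
        obtain ⟨k, hk⟩ := (mem_filter.1 hx).2; have := hvv₁ x; omega)
      linarith
  choose v₂ hv₂ using hv4
  have hvv₂ : ∀ x, v x = 4 * v₂ x := fun x => by rw [hvv₁ x, hv₂ x]; ring
  -- LEVEL 3: `v/4` is even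
  have hv8 : ∀ x, Even (v₂ x) := by
    rcases to12_level v₂ 9 (fun I hI => by
      have h8 := (hcc I).2.2 (by omega)
      rw [sum_congr rfl (fun x _ => hvv₂ x), ← mul_sum] at h8
      omega) with h | h
    · exact h
    · exfalso
      have hcnt : (8 : ℤ) ≤ #(univ.filter fun x => Odd (v₂ x)) := by norm_num at h; exact_mod_cast (by omega)
      have hge := hXset (univ.filter fun x => Odd (v₂ x)) 4 (by norm_num) (fun x hx => by
        obtain ⟨k, hk⟩ := (mem_filter.1 hx).2; have := hvv₂ x; omega)
      linarith
  -- LEVEL 4: a wild point costs `≥ 3712`; two are too many, none gives `Φ = 15/16`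
  have hX8 : ∀ x, v x ≠ 0 → 3712 ≤ X x := by
    intro x hx
    have h8 : 8 ≤ v x ∨ v x ≤ -8 := by obtain ⟨k, hk⟩ := hv8 x; have := hvv₂ x; omega
    have h1 := to12_excess _ _ 8 (hτ₀val x) (by norm_num) h8
    simp only [X]; linarith
  have hsome : ∃ x₀, v x₀ ≠ 0 := by
    by_contra hnone
    push Not at hnone
    have hT8192 : (∑ x, (u x - 4 * sZ (f x)) ^ 2 : ℤ) = 8192 := by
      rw [hTdec, hsumτ₀, hE512, sum_eq_zero (fun x _ => by simp only [X]; rw [hnone x]; ring)]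
      norm_num
    have hΦeq : forrelation f g = 15 / 16 := by
      have h : ((∑ x, (u x - 4 * sZ (f x)) ^ 2 : ℤ) : ℝ) = 8192 := by exact_mod_cast hT8192
      rw [hbud] at h
      linarith
    rw [hΦeq] at hΦle
    norm_num at hΦle
  obtain ⟨x₀, hx₀⟩ := hsome
  have hothers : ∀ x, x ≠ x₀ → v x = 0 := by
    intro x hx
    by_contra hvx0
    have h2 : X x + X x₀ ≤ ∑ y, X y := by
      rw [← sum_pair hx]
      exact sum_le_sum_of_subset_of_nonneg (subset_univ _) fun y _ _ => hXnn y
    linarith [hX8 x hvx0, hX8 x₀ hx₀]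
  have hv16 : v x₀ = 8 ∨ v x₀ = -8 := by
    by_contra hcon
    have h16 : 16 ≤ v x₀ ∨ v x₀ ≤ -16 := by
      obtain ⟨k, hk⟩ := hv8 x₀; have := hvv₂ x₀; omega
    have h1 := to12_excess _ _ 16 (hτ₀val x₀) (by norm_num) h16
    have h2 : X x₀ ≤ ∑ y, X y := single_le_sum (fun y _ => hXnn y) (mem_univ x₀)
    simp only [X] at h2
    linarith
  -- the single wild point costs exactly `3712`: `Σ X = X(x₀) = 4096 + 16 τ₀(x₀) v(x₀) ≤ 3839` forces `τ₀ v = −24`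
  have hXx₀ : ∑ y, X y = X x₀ := by
    rw [← Finset.sum_erase_add _ _ (mem_univ x₀), sum_eq_zero fun y hy => ?_, zero_add]
    simp only [X]; rw [hothers y (ne_of_mem_erase hy)]; ring
  have hX3712 : X x₀ = 3712 := by
    have hle : X x₀ ≤ 3839 := by rw [← hXx₀]; exact hXsum
    simp only [X] at hle ⊢
    rcases hv16 with h8 | h8 <;> rw [h8] at hle ⊢ <;> rcases hτ₀val x₀ with h | h | h | h <;> rw [h] at hle ⊢ <;>
      norm_num at hle <;> norm_num
  have hΦeq : forrelation f g = 931 / 1024 := by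
    have hT11904 : (∑ x, (u x - 4 * sZ (f x)) ^ 2 : ℤ) = 11904 := by rw [hTX, hXx₀, hX3712]; norm_num
    have h : ((∑ x, (u x - 4 * sZ (f x)) ^ 2 : ℤ) : ℝ) = 11904 := by exact_mod_cast hT11904
    rw [hbud] at h
    linarith
  refine ⟨hΦeq, x₀, fun x hx => ?_, ?_⟩
  · have h := hvx x; rw [hothers x hx] at h; simp only [τ₀] at h; linarith
  · have h := hvx x₀
    simp only [τ₀] at h
    rcases hv16 with h8 | h8 <;> rw [h8] at h
    · left; linarith
    · right; linarith

/-- **The 9-flat base pattern is dead above `930/1024`**: type O, `#E = 512`, `Φ > 930/1024` is impossible (`Φ` would be `931/1024`, dead by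
`to19_typeO_E512_ge931_false`).  NOT summit progress. [this work] -/
theorem to19_typeO_E512_gt930_false (f g : (Fin (6 + 6) → Bool) → Bool) (hf : IsDegLeFun 3 f) (hg : IsDegLeFun 3 g)
    (u : (Fin (6 + 6) → Bool) → ℤ) (hu : ∀ x, W (fun y => signOf (g y)) x = (2 : ℝ) ^ 4 * (u x : ℝ))
    (hodd : ∃ x, Odd (u x)) (hE512 : #(univ.filter fun x : Fin (6 + 6) → Bool => (Odd (u x / 2) ↔ Odd (u x / 2 / 2))) = 512)
    (hΦ : (930 / 1024 : ℝ) < forrelation f g) : False := by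
  obtain ⟨hΦeq, -⟩ := to19_typeO_E512_gt930_boundary f g hf hg u hu hodd hE512 hΦ
  exact to19_typeO_E512_ge931_false f g hf hg u hu hodd hE512 (by rw [hΦeq])

end Summit.QuantumAdvantage.QuantumAdvantage.Theorems.CubicForrelation.NearExactIsExact

end
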